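import Summits.BirchSwinnertonDyer.BirchSwinnertonDyer.Theorems.ResidualThetaTransportAtTwoAwayDefs
import Summits.BirchSwinnertonDyer.BirchSwinnertonDyer.Theorems.ResidualThetaTransportAtTwoResidualSignedLambdaLowerCMAtTwoRhoLayerPairingCompat
import Literature.NumberTheory.EllipticCurves.GreenbergSelmerCofreeReductionPkProofs
import Literature.NumberTheory.EllipticCurves.Kato2004.UniversalNormsCoeffFramed
import Literature.NumberTheory.EllipticCurves.PadicCoeffIntegersFrobeniusData
import HarnessLib

/-!
# S4₂ `stub_deepHalfAtTwoStrict` — the PIN-ONLY inputs of the assembly p697034, as theorems about `π : OnePairPins …`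

Route `ResidualThetaTransportAtTwo` (RTT), crux RSL_g `ResidualSignedLambdaLowerCMAtTwo` (stmt-BirchSwinnertonDyer-22608), line «onepair» (skeleton
v3a), split stub S4₂ `stub_deepHalfAtTwoStrict` (lane of seat `prover-bsd-wall-tp2-p2x-w2`, g20; `--supports`, closes nothing). THEOREMS ONLY (no
definition, no named fact, no instance, no `sorry`).

The by-name S4₂ body is `CofreeSelmerTransfer.exists_iwasawaH1_locd₂_eq_strict_of_pins` (p697034) fed with the fields of `π`/`π₂`/`πₐ`; w2 g19's input
audit (cell STATUS 2026-08-29T05:50:28Z) lists the inputs that are NOT literally fields of the pin bundles. This file supplies the ones that ARE derivable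
from `OnePairPins` alone:

* §1 `OnePairPins.toZModPow_t₀_eq_zero_of_ePk_eq_one`, **`OnePairPins.ePk_nondegenerate`** — the tower `e_k` is non-degenerate at every level
  (`hnondeg` of p695648/p697034/p697362): from the value formula `hePk`, primitivity `hζ`, the dual-basis expansion `hbO` and `T/2^kT ≅ A[2^k]`
  (`divPowCofreeMkTorsion_surjective`, `divPowCofreeMk_eq_zero_iff`).
* §2 `OnePairPins.cofreeTorsionPow_divPowCofreeMkTorsion_succ`, **`OnePairPins.ePk_tower_of_zeta_sq`** — IF the chosen roots are compatible,
  `ζ_{k+1}² = ζ_k`, THEN the tower is compatible: `e_k(2a, 2b) = e_{k+1}(a, b)²` (`htower` of p695648/p697362). The compatibility of `ζ` is NOT a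
  field of `OnePairPins` as recorded (its docstring says «compatible», its field `hζ` only says primitive) — this is the one binder the S4₂/S4₀ texts
  must carry (v3b); this lemma turns that binder into `htower`.
* §3 `OnePairPins.isUnramifiedAt_of_habitat` — the texts' habitat clause `∀ v, ¬ ℓ_v ∣ 2M → ρ unramified at v` together with `ℓ_v ∣ M → v ∈ S₀`
  gives p697034's `hρ : ∀ w ∉ S₀, 2 ∉ w → ρ.IsUnramifiedAt w`; `compactSpace_coeffO_of_finiteDimensional` — `𝒪` is compact for a newform's `ι`.

BSD is not proved by any of this; RSL_g (22608) and K3 (20308) stay OPEN.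

References: [Kato2004Asterisque] §13.8 (pp. 228–229), §14.9 (p. 239); [Greenberg1989] §1 p. 98; [Washington1997] §13.1;
[SerreLocalFields1979] II §1 Prop. 1.
-/

set_option autoImplicit false
-- the Theorems namespace of this sub repeats the summit name by design (D-0017 nested layout)
set_option linter.dupNamespace false

noncomputable section

open scoped Classical

namespace Summit.BirchSwinnertonDyer.BirchSwinnertonDyer.Theorems.OnePair.OnePairPins

open CategoryTheory Field NumberField IsDedekindDomain
  Literature.NumberTheory.EllipticCurves Literature.NumberTheory.GaloisRepresentations
  Literature.NumberTheory.EllipticCurves.GreenbergSelmer Literature.NumberTheory.EllipticCurves.Kobayashi2003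
  Rat.HeightOneSpectrum
  Summit.BirchSwinnertonDyer.BirchSwinnertonDyer.Theorems.ThetaTransport

variable {S : Set (PadicAlgCl 2)} {W : WeierstrassCurve ℚ} [W.IsElliptic] {κ : ZpExtension ℚ 2} {γ : absoluteGaloisGroup ℚ}
  {S₀ : Finset (HeightOneSpectrum (𝓞 ℚ))} {n : ℕ} {ρ : FramedGaloisRep ℚ ↥(padicCoeffIntegers S) 2}
  {Θ : ∀ v : HeightOneSpectrum (𝓞 ℚ), ((2 : ℕ) : 𝓞 ℚ) ∈ v.asIdeal → (Cofree ρ ↥(padicCoeffField S) ≃+ (Fin n → ↥(W.geomPrimaryTorsion 2)))}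
  {hΘ : ∀ v hv (δ : absoluteGaloisGroup (v.adicCompletion ℚ)) m i,
    Θ v hv (resGalOfEmb (closureEmb (K := ℚ) (v.adicCompletion ℚ)) δ • m) i = resGalOfEmb (closureEmb (K := ℚ) (v.adicCompletion ℚ)) δ • Θ v hv m i}
  {I : Kato2004.IwasawaH1DataCoeff (FramedGaloisRep.toGaloisRep ρ) 2 κ γ}
  {Sg : AddSubgroup (subgroupH1 κ.kerSubgroup (Cofree ρ ↥(padicCoeffField S)))} [Module ↥(padicCoeffIntegers S) ↥Sg]
  (π : OnePairPins S W κ γ S₀ n ρ Θ hΘ I Sg)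

/-! ## §1 Non-degeneracy of the tower at every level -/

/-- If `e_k(2^{-k}s, 2^{-k}t) = 1` then `t₀(s₀t₁ − s₁t₀) ≡ 0 (mod 2^k)`: the exponent in the value formula `hePk` is the canonical residue
`< 2^k`, and `ζ_k` has exact order `2^k`. [cite: Kato2004Asterisque, §13.8 (pp. 228–229)] -/
theorem toZModPow_t₀_eq_zero_of_ePk_eq_one (k : ℕ) (s t : Fin 2 → ↥(padicCoeffIntegers S))
    (h : π.ePk k (divPowCofreeMkTorsion S ρ k s) (divPowCofreeMkTorsion S ρ k t) = 1) :
    PadicInt.toZModPow k (π.t₀ (s 0 * t 1 - s 1 * t 0)) = 0 := by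
  rw [π.hePk] at h
  have hdvd := ((π.hζ k).pow_eq_one_iff_dvd _).mp h
  have hlt := ZMod.val_lt (PadicInt.toZModPow k (π.t₀ (s 0 * t 1 - s 1 * t 0)))
  exact (ZMod.val_eq_zero _).mp (Nat.eq_zero_of_dvd_of_lt hdvd hlt)

/-- An element `x ∈ 𝒪` all of whose multiples have `t₀`-value in `2^k ℤ₂` lies in `2^k 𝒪` (dual-basis expansion `hbO`).
[cite: Kato2004Asterisque, §14.9 (p. 239)] -/
theorem mem_span_pow_of_forall_t₀_mul (k : ℕ) (x : ↥(padicCoeffIntegers S))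
    (hx : ∀ a : ↥(padicCoeffIntegers S), π.t₀ (x * a) ∈ Ideal.span {((2 : ℕ) : ℤ_[2]) ^ k}) :
    x ∈ Ideal.span {((2 : ℕ) : ↥(padicCoeffIntegers S)) ^ k} := by
  rw [π.hbO x]
  refine Ideal.sum_mem _ fun i _ ↦ ?_
  obtain ⟨c, hc⟩ := Ideal.mem_span_singleton'.mp (hx (π.bO' i))
  rw [← hc, map_mul, map_pow, map_natCast]
  exact Ideal.mem_span_singleton'.mpr ⟨padicIntToCoeffIntegers S c * π.bO i, by ring⟩

/-- **The tower is non-degenerate at every level** (`hnondeg` of the S4₂/S4₀ assemblies p695648/p697362): if `e_k(a, T) = 1` for all `a` then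
`T = 0`. Write `T = 2^{-k}t`; testing against `2^{-k}(a, 0)` and `2^{-k}(0, −a)` gives `t₀(a t₁), t₀(a t₀) ∈ 2^kℤ₂` for all `a`, so both
coordinates of `t` lie in `2^k𝒪` and `2^{-k}t = 0` in `A_ρ`. [cite: Kato2004Asterisque, §13.8 (pp. 228–229)] [cite: Greenberg1989, §1 p. 98] -/
theorem ePk_nondegenerate (k : ℕ) (T : ↥(AddSubgroup.torsionBy (Cofree ρ ↥(padicCoeffField S)) ((2 ^ k : ℕ) : ℤ)))
    (h : ∀ a, π.ePk k a T = 1) : T = 0 := by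
  obtain ⟨t, rfl⟩ := divPowCofreeMkTorsion_surjective S ρ k T
  have key : ∀ s : Fin 2 → ↥(padicCoeffIntegers S),
      π.t₀ (s 0 * t 1 - s 1 * t 0) ∈ Ideal.span {((2 : ℕ) : ℤ_[2]) ^ k} := fun s ↦ by
    rw [← PadicInt.ker_toZModPow, RingHom.mem_ker]
    exact π.toZModPow_t₀_eq_zero_of_ePk_eq_one k s t (h _)
  have h1 : t 1 ∈ Ideal.span {((2 : ℕ) : ↥(padicCoeffIntegers S)) ^ k} := by
    refine π.mem_span_pow_of_forall_t₀_mul k (t 1) fun a ↦ ?_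
    have := key ![a, 0]
    simpa [mul_comm] using this
  have h0 : t 0 ∈ Ideal.span {((2 : ℕ) : ↥(padicCoeffIntegers S)) ^ k} := by
    refine π.mem_span_pow_of_forall_t₀_mul k (t 0) fun a ↦ ?_
    have := key ![0, -a]
    simpa [mul_comm] using this
  refine Subtype.ext ?_
  rw [coe_divPowCofreeMkTorsion_apply, ZeroMemClass.coe_zero, divPowCofreeMk_eq_zero_iff]
  intro i
  fin_cases i
  · exact h0
  · exact h1

/-! ## §2 Compatibility of the tower from compatibility of the roots -/

/-- `[2]` on `A_ρ[2^{k+1}]` takes `2^{-(k+1)}s` to `2^{-k}s` (`smul_divPowCofreeMk_succ`). [cite: Kato2004Asterisque, §13.8 (p. 228)] -/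
theorem cofreeTorsionPow_divPowCofreeMkTorsion_succ (k : ℕ) (s : Fin 2 → ↥(padicCoeffIntegers S)) :
    (cofreeTorsionPow S ρ k).hom (divPowCofreeMkTorsion S ρ (k + 1) s) = divPowCofreeMkTorsion S ρ k s := by
  refine Subtype.ext ?_
  rw [coe_cofreeTorsionPow_apply, coe_divPowCofreeMkTorsion_apply, coe_divPowCofreeMkTorsion_apply, natCast_zsmul,
    smul_divPowCofreeMk_succ]

/-- The residue mod `2^k` of `x ∈ ℤ₂` is the residue mod `2^{k+1}` reduced: `(x mod 2^k).val = (x mod 2^{k+1}).val % 2^k`.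
[cite: Washington1997, §13.1] -/
theorem val_toZModPow_eq_mod (k : ℕ) (x : ℤ_[2]) :
    (PadicInt.toZModPow k x).val = (PadicInt.toZModPow (k + 1) x).val % 2 ^ k := by
  rw [← PadicInt.cast_toZModPow k (k + 1) k.le_succ x, ZMod.cast_eq_val, ZMod.val_natCast]

/-- **Compatible roots ⟹ compatible tower** (`htower` of the S4₂/S4₀ assemblies p695648/p697362): if `ζ_{k+1}² = ζ_k` for all `k`, then
`e_k(2a, 2b) = e_{k+1}(a, b)²` on `A_ρ[2^{k+1}]`. Both sides are `ζ_k^{t₀(s ∧ t)}` by the value formula `hePk` (`a = 2^{-(k+1)}s`,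
`b = 2^{-(k+1)}t`, `T/2^{k+1}T ↠ A[2^{k+1}]`), the exponents agreeing mod `2^k`. [cite: Kato2004Asterisque, §13.8 (pp. 228–229)] -/
theorem ePk_tower_of_zeta_sq (hζ2 : ∀ k, π.ζ (k + 1) ^ 2 = π.ζ k) (k : ℕ)
    (a b : ↥(AddSubgroup.torsionBy (Cofree ρ ↥(padicCoeffField S)) ((2 ^ (k + 1) : ℕ) : ℤ))) :
    π.ePk k ((cofreeTorsionPow S ρ k).hom a) ((cofreeTorsionPow S ρ k).hom b) = π.ePk (k + 1) a b ^ 2 := by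
  obtain ⟨s, rfl⟩ := divPowCofreeMkTorsion_surjective S ρ (k + 1) a
  obtain ⟨t, rfl⟩ := divPowCofreeMkTorsion_surjective S ρ (k + 1) b
  rw [cofreeTorsionPow_divPowCofreeMkTorsion_succ, cofreeTorsionPow_divPowCofreeMkTorsion_succ, π.hePk, π.hePk, ← pow_mul,
    pow_mul', hζ2, val_toZModPow_eq_mod k]
  conv_rhs => rw [← Nat.div_add_mod (PadicInt.toZModPow (k + 1) (π.t₀ (s 0 * t 1 - s 1 * t 0))).val (2 ^ k), pow_add, pow_mul,
    (π.hζ k).pow_eq_one, one_pow, one_mul]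

/-! ## §3 The habitat clause and compactness of `𝒪` -/

/-- `ℓ_v = 2` forces `2 ∈ v` (the place of `ℚ` under `v` is generated by `ℓ_v`). [cite: Washington1997, §13.1] -/
private theorem two_mem_asIdeal_of_natGenerator_eq_two {v : HeightOneSpectrum (𝓞 ℚ)} (hv : natGenerator v = 2) :
    ((2 : ℕ) : 𝓞 ℚ) ∈ v.asIdeal := by
  have h := (natGenerator_dvd_iff v (n := 2)).mp (hv ▸ dvd_rfl)
  rwa [← map_natCast (Rat.IsIntegralClosure.intEquiv (𝓞 ℚ)), Ideal.apply_mem_of_equiv_iff] at h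

omit [W.IsElliptic] in
/-- **The habitat clause gives `hρ`.** If `ρ` is unramified at every `v` with `ℓ_v ∤ 2M` and every `v` with `ℓ_v ∣ M` lies in `S₀`, then `ρ` is
unramified at every `w ∉ S₀` with `2 ∉ w` (`ℓ_w` is prime: `ℓ_w ∣ 2M` forces `ℓ_w = 2` or `ℓ_w ∣ M`). This is the shape p697034 consumes.
[cite: Kato2004Asterisque, §14.9 (p. 239)] -/
theorem isUnramifiedAt_of_habitat {M : ℕ} (hρ : ∀ v : HeightOneSpectrum (𝓞 ℚ), ¬ natGenerator v ∣ 2 * M → ρ.IsUnramifiedAt v)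
    (hM : ∀ v : HeightOneSpectrum (𝓞 ℚ), natGenerator v ∣ M → v ∈ S₀) (w : HeightOneSpectrum (𝓞 ℚ)) (hw : w ∉ S₀)
    (h2 : ((2 : ℕ) : 𝓞 ℚ) ∉ w.asIdeal) : ρ.IsUnramifiedAt w := by
  refine hρ w fun hdvd ↦ ?_
  rcases (Nat.Prime.dvd_mul (prime_natGenerator w)).mp hdvd with h | h
  · exact h2 (two_mem_asIdeal_of_natGenerator_eq_two ((Nat.prime_dvd_prime_iff_eq (prime_natGenerator w) Nat.prime_two).mp h))
  · exact hw (hM w h)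

/-- **`𝒪 = coeffO (Set.range ι)` is compact** when the coefficient field of `g` is finite over `ℚ` (in the texts: from `IsNewform0 g` via
`IsNewform0.finiteDimensional_coeffField_holds`): `ℚ₂(ι K_g)` is finite over `ℚ₂` (`GreenbergSelmer.finiteDimensional_padicCoeffField`) and its
closed unit ball is compact (`UniversalNorms.compactSpace_padicCoeffIntegers`). [cite: SerreLocalFields1979, II §1 Prop. 1] -/
theorem compactSpace_coeffO_of_finiteDimensional {Γ : Subgroup (GL (Fin 2) ℝ)} {k : ℤ} {g : CuspForm Γ k}
    [FiniteDimensional ℚ (ModularForms.coeffField g)] (ι : ModularForms.coeffField g →+* PadicAlgCl 2) :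
    CompactSpace (coeffO (Set.range ι)) := by
  haveI : FiniteDimensional ℚ_[2] ↥(padicCoeffField (Set.range ι)) := GreenbergSelmer.finiteDimensional_padicCoeffField ι
  exact Kato2004.UniversalNorms.compactSpace_padicCoeffIntegers (Set.range ι)

end Summit.BirchSwinnertonDyer.BirchSwinnertonDyer.Theorems.OnePair.OnePairPins

end
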